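import Summits.Ventures.HodgeRepro2.T5SU11SphericalLegendreHigher
import Summits.Ventures.HodgeRepro2.T5SU11SphericalMonotone
import Mathlib.Analysis.SpecialFunctions.Arcosh

/-!
# The spherical functions of even integer parameter are the Legendre polynomials: `φ_{2n+2}(a_t) = P_n(cosh 2t)`
for EVERY `n`

`T5SU11SphericalLegendreHigher` identifies `φ_4 = P_1`, `φ_6 = P_2`, `φ_8 = P_3` in `cosh 2t` one by one, through the
uniqueness theorem `T5SU11SphericalUnique.eq_sph_hyp_of_ode`. This file does all `n` at once. The Legendre
polynomials are DEFINED here by Bonnet's three-term recursion (as real functions, together with their first and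
second derivatives, `legP`, `legQ`, `legR`):

  `P_0 = 1`, `P_1 = x`, `(n + 2) P_{n+2} = (2n + 3) x P_{n+1} − (n + 1) P_n`,

and the two classical identities are proved by a joint induction (`legendre_identities`):

  **`P'_{n+1} = x P'_n + (n + 1) P_n`**,  **`(x² − 1) P'_n = (n + 1)(P_{n+1} − x P_n)`**;

differentiating the second and using the first gives **Legendre's equation**
`(x² − 1) P''_n + 2x P'_n = n(n + 1) P_n` (`legendre_ode`). With `x = cosh 2t` this is the radial equation
`(sinh 2t · u')' = λ(λ − 2) sinh 2t · u` for `λ = 2n + 2`, and `P_n(1) = 1` (`legP_one`), so by uniqueness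

  **`φ_{2n+2}(a_t) = P_n(cosh 2t)`**   (`sph_even_hyp`),

on the group **`φ_{2n+2}(g) = P_n(2|a(g)|² − 1) = P_n(φ_4(g))`** (`sph_even_eq`, `sph_even_eq_sph_four`), Bonnet's
recursion becomes a three-term recursion of spherical functions with `φ_4` as the multiplier,
`(n + 2) φ_{2n+6} = (2n + 3) φ_4 φ_{2n+4} − (n + 1) φ_{2n+2}` (`sph_even_recursion`), and by the functional equation
`φ_{−2n}(a_t) = P_n(cosh 2t)` (`sph_neg_even_hyp`). The cases `n = 2, 3` recover `φ_6`, `φ_8` (`legP_two`, `legP_three`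
are the explicit polynomials of `T5SU11SphericalLegendreHigher`). Conversely the group gives Legendre facts:
**`P_n(x) ≥ 1` and `P_n` strictly increasing on `[1, ∞)`** (`one_le_legP`, `strictMonoOn_legP`), read off
`φ_{2n+2}(a_t) ≥ 1` and the strict monotonicity of `t ↦ φ_λ(a_t)` for `λ > 2`. Nothing is claimed about (N).

Blind lane: Mathlib + the HodgeRepro2 prefix only; no sorry; axioms ⊆ {propext, Classical.choice,
Quot.sound}.
-/

namespace Summit.Ventures.HodgeRepro2.T5SU11SphericalLegendreAll

open MeasureTheory Metric Set Filter Topology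
open T5SU11Unimodular T5SU11Cartan T5SU11OneParameter T5SU11CartanProjection T5BergmanCoefficient
  T5SU11SphericalFunction T5SU11SphericalSymmetry T5SU11SphericalBounds T5SU11SphericalMonotone
  T5SU11SphericalODE T5SU11SphericalLegendre T5SU11SphericalUnique T5SU11SphericalLegendreHigher

/-! ### Bonnet's recursion -/

/-- **The Legendre polynomials** as real functions, by Bonnet's recursion
`(n + 2) P_{n+2} = (2n + 3) x P_{n+1} − (n + 1) P_n`, `P_0 = 1`, `P_1 = x`. -/
noncomputable def legP : ℕ → ℝ → ℝ
  | 0 => fun _ => 1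
  | 1 => fun x => x
  | (n + 2) => fun x => ((2 * (n : ℝ) + 3) * x * legP (n + 1) x - ((n : ℝ) + 1) * legP n x) / ((n : ℝ) + 2)

/-- The derivatives `P'_n`, by the differentiated recursion. -/
noncomputable def legQ : ℕ → ℝ → ℝ
  | 0 => fun _ => 0
  | 1 => fun _ => 1
  | (n + 2) => fun x => ((2 * (n : ℝ) + 3) * (legP (n + 1) x + x * legQ (n + 1) x) - ((n : ℝ) + 1) * legQ n x)
      / ((n : ℝ) + 2)

/-- The second derivatives `P''_n`, by the twice differentiated recursion. -/
noncomputable def legR : ℕ → ℝ → ℝ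
  | 0 => fun _ => 0
  | 1 => fun _ => 0
  | (n + 2) => fun x => ((2 * (n : ℝ) + 3) * (2 * legQ (n + 1) x + x * legR (n + 1) x) - ((n : ℝ) + 1) * legR n x)
      / ((n : ℝ) + 2)

/-- `P_0 = 1`. -/
@[simp] lemma legP_zero (x : ℝ) : legP 0 x = 1 := rfl

/-- `P_1(x) = x`. -/
@[simp] lemma legP_one' (x : ℝ) : legP 1 x = x := rfl

/-- Bonnet's recursion, unfolded. -/
lemma legP_succ_succ (n : ℕ) (x : ℝ) :
    legP (n + 2) x = ((2 * (n : ℝ) + 3) * x * legP (n + 1) x - ((n : ℝ) + 1) * legP n x) / ((n : ℝ) + 2) := rfl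
/-- `P'_0 = 0`. -/
@[simp] lemma legQ_zero (x : ℝ) : legQ 0 x = 0 := rfl

/-- `P'_1 = 1`. -/
@[simp] lemma legQ_one (x : ℝ) : legQ 1 x = 1 := rfl

/-- The differentiated recursion, unfolded. -/
lemma legQ_succ_succ (n : ℕ) (x : ℝ) :
    legQ (n + 2) x = ((2 * (n : ℝ) + 3) * (legP (n + 1) x + x * legQ (n + 1) x) - ((n : ℝ) + 1) * legQ n x)
      / ((n : ℝ) + 2) := rfl
/-- `P''_0 = 0`. -/
@[simp] lemma legR_zero (x : ℝ) : legR 0 x = 0 := rfl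

/-- `P''_1 = 0`. -/
@[simp] lemma legR_one (x : ℝ) : legR 1 x = 0 := rfl

/-- The twice differentiated recursion, unfolded. -/
lemma legR_succ_succ (n : ℕ) (x : ℝ) :
    legR (n + 2) x = ((2 * (n : ℝ) + 3) * (2 * legQ (n + 1) x + x * legR (n + 1) x) - ((n : ℝ) + 1) * legR n x)
      / ((n : ℝ) + 2) := rfl

/-- `P_2(x) = (3x² − 1)/2`. -/
theorem legP_two (x : ℝ) : legP 2 x = (3 * x ^ 2 - 1) / 2 := by
  rw [legP_succ_succ]
  simp only [Nat.cast_zero, zero_add, legP_one', legP_zero]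
  ring

/-- `P_3(x) = (5x³ − 3x)/2`. -/
theorem legP_three (x : ℝ) : legP 3 x = (5 * x ^ 3 - 3 * x) / 2 := by
  rw [legP_succ_succ, legP_two]
  simp only [Nat.cast_one, legP_one']
  ring

/-- **`P_n(1) = 1`** for every `n`. -/
theorem legP_one (n : ℕ) : legP n 1 = 1 := by
  induction n using Nat.strong_induction_on with
  | _ n ih =>
    match n with
    | 0 => rfl
    | 1 => rfl
    | n + 2 =>
      rw [legP_succ_succ, ih (n + 1) (by omega), ih n (by omega)]
      have : (n : ℝ) + 2 ≠ 0 := by positivity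
      field_simp
      ring

/-! ### Differentiability -/

/-- **`P_n` has derivative `P'_n = legQ n`** (both `n` and `n + 1` carried along the induction). -/
theorem hasDerivAt_legP_pair (n : ℕ) (x : ℝ) :
    HasDerivAt (legP n) (legQ n x) x ∧ HasDerivAt (legP (n + 1)) (legQ (n + 1) x) x := by
  induction n with
  | zero =>
    constructor
    · show HasDerivAt (fun _ : ℝ => (1 : ℝ)) 0 x
      exact hasDerivAt_const x (1 : ℝ)
    · show HasDerivAt (fun y : ℝ => y) 1 x
      exact hasDerivAt_id x
  | succ n ih =>
    refine ⟨ih.2, ?_⟩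
    have h := ((((hasDerivAt_id x).const_mul (2 * (n : ℝ) + 3)).mul ih.2).sub (ih.1.const_mul ((n : ℝ) + 1)))
      |>.div_const ((n : ℝ) + 2)
    refine (h.congr_deriv ?_).congr_of_eventuallyEq (Filter.Eventually.of_forall fun y => rfl)
    rw [legQ_succ_succ]
    simp only [id_eq]
    ring

/-- **`P_n` is differentiable with derivative `legQ n`.** -/
theorem hasDerivAt_legP (n : ℕ) (x : ℝ) : HasDerivAt (legP n) (legQ n x) x := (hasDerivAt_legP_pair n x).1

/-- **`P'_n` has derivative `P''_n = legR n`.** -/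
theorem hasDerivAt_legQ_pair (n : ℕ) (x : ℝ) :
    HasDerivAt (legQ n) (legR n x) x ∧ HasDerivAt (legQ (n + 1)) (legR (n + 1) x) x := by
  induction n with
  | zero =>
    constructor
    · show HasDerivAt (fun _ : ℝ => (0 : ℝ)) 0 x
      exact hasDerivAt_const x (0 : ℝ)
    · show HasDerivAt (fun _ : ℝ => (1 : ℝ)) 0 x
      exact hasDerivAt_const x (1 : ℝ)
  | succ n ih =>
    refine ⟨ih.2, ?_⟩
    have h := ((((hasDerivAt_legP (n + 1) x).add ((hasDerivAt_id x).mul ih.2)).const_mul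
      (2 * (n : ℝ) + 3)).sub (ih.1.const_mul ((n : ℝ) + 1))).div_const ((n : ℝ) + 2)
    refine (h.congr_deriv ?_).congr_of_eventuallyEq (Filter.Eventually.of_forall fun y => rfl)
    rw [legR_succ_succ]
    simp only [id_eq]
    ring

/-- **`P'_n` is differentiable with derivative `legR n`.** -/
theorem hasDerivAt_legQ (n : ℕ) (x : ℝ) : HasDerivAt (legQ n) (legR n x) x := (hasDerivAt_legQ_pair n x).1

/-! ### The two classical identities and Legendre's equation -/

/-- **The two identities** `P'_{n+1} = x P'_n + (n + 1) P_n` and `(x² − 1) P'_n = (n + 1)(P_{n+1} − x P_n)`,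
by a joint induction on `n`. -/
theorem legendre_identities (n : ℕ) (x : ℝ) :
    legQ (n + 1) x = x * legQ n x + ((n : ℝ) + 1) * legP n x ∧
      (x ^ 2 - 1) * legQ n x = ((n : ℝ) + 1) * (legP (n + 1) x - x * legP n x) := by
  induction n with
  | zero => simp
  | succ n ih =>
    obtain ⟨h1, h2⟩ := ih
    have hn : ((n : ℝ) + 2) ≠ 0 := by positivity
    constructor
    · -- `P'_{n+2} = x P'_{n+1} + (n + 2) P_{n+1}` from the differentiated recursion and the two identities at `n`
      rw [legQ_succ_succ, div_eq_iff hn]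
      push_cast
      linear_combination ((n : ℝ) + 1) * x * h1 + ((n : ℝ) + 1) * h2
    · -- `(x² − 1) P'_{n+1} = (n + 2)(P_{n+2} − x P_{n+1})` from Bonnet's recursion and the identities at `n`
      have e : ((n : ℝ) + 1 + 1) * (((2 * (n : ℝ) + 3) * x * legP (n + 1) x - ((n : ℝ) + 1) * legP n x)
            / ((n : ℝ) + 2) - x * legP (n + 1) x)
          = ((2 * (n : ℝ) + 3) * x * legP (n + 1) x - ((n : ℝ) + 1) * legP n x)
            - ((n : ℝ) + 2) * (x * legP (n + 1) x) := by
        rw [show (n : ℝ) + 1 + 1 = (n : ℝ) + 2 by ring]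
        field_simp
      rw [legP_succ_succ, h1]
      push_cast
      rw [e]
      linear_combination x * h2

/-- **LEGENDRE'S EQUATION**: `(x² − 1) P''_n + 2x P'_n = n(n + 1) P_n` for every `n`. -/
theorem legendre_ode (n : ℕ) (x : ℝ) :
    (x ^ 2 - 1) * legR n x + 2 * x * legQ n x = (n : ℝ) * ((n : ℝ) + 1) * legP n x := by
  -- differentiate the identity `(x² − 1) P'_n − (n + 1)(P_{n+1} − x P_n) ≡ 0`
  set F : ℝ → ℝ := fun y => (y ^ 2 - 1) * legQ n y - ((n : ℝ) + 1) * (legP (n + 1) y - y * legP n y) with hF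
  have hF0 : F = fun _ => 0 := by
    funext y
    rw [hF]
    simp only
    linear_combination (legendre_identities n y).2
  have hsq : HasDerivAt (fun y : ℝ => y ^ 2 - 1) (2 * x) x := by
    simpa using (hasDerivAt_pow 2 x).sub_const 1
  have hd : HasDerivAt F (2 * x * legQ n x + (x ^ 2 - 1) * legR n x
      - ((n : ℝ) + 1) * (legQ (n + 1) x - (legP n x + x * legQ n x))) x := by
    have h := (hsq.mul (hasDerivAt_legQ n x)).sub
      (((hasDerivAt_legP (n + 1) x).sub ((hasDerivAt_id x).mul (hasDerivAt_legP n x))).const_mul ((n : ℝ) + 1))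
    refine h.congr_deriv ?_
    simp only [id_eq]
    ring
  rw [hF0] at hd
  have h0 := hd.unique (hasDerivAt_const x (0 : ℝ))
  have h1 := (legendre_identities n x).1
  rw [h1] at h0
  linear_combination h0

/-! ### The spherical functions of even integer parameter -/

section measure

variable [MeasurableSpace Circle] [BorelSpace Circle]

/-- **`φ_{2n+2}(a_t) = P_n(cosh 2t)`** for every `n` and every `t`. -/
theorem sph_even_hyp (n : ℕ) (t : ℝ) : sph (2 * (n : ℝ) + 2) (hyp t) = legP n (Real.cosh (2 * t)) := by
  symm
  refine eq_sph_hyp_of_ode (2 * (n : ℝ) + 2) (v := fun t => legP n (Real.cosh (2 * t)))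
    (v' := fun t => 2 * Real.sinh (2 * t) * legQ n (Real.cosh (2 * t)))
    (v'' := fun t => 4 * Real.cosh (2 * t) * legQ n (Real.cosh (2 * t))
      + 4 * Real.sinh (2 * t) ^ 2 * legR n (Real.cosh (2 * t)))
    (fun t => ?_) (fun t => ?_) (fun t => ?_) ?_ t
  · have h := (hasDerivAt_legP n (Real.cosh (2 * t))).comp t (hasDerivAt_cosh_two_mul_self t)
    refine h.congr_deriv ?_
    ring
  · have h := (hasDerivAt_sinh_two_mul_self t).const_mul 2 |>.mul
      ((hasDerivAt_legQ n (Real.cosh (2 * t))).comp t (hasDerivAt_cosh_two_mul_self t))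
    refine h.congr_deriv ?_
    simp only [Function.comp_apply]
    ring
  · have hode := legendre_ode n (Real.cosh (2 * t))
    have hcs : Real.sinh (2 * t) ^ 2 = Real.cosh (2 * t) ^ 2 - 1 := by
      have := Real.cosh_sq (2 * t)
      linarith
    rw [hcs]
    linear_combination (4 * Real.sinh (2 * t)) * hode
  · simp only [mul_zero, Real.cosh_zero, legP_one]

/-- **On the group**: `φ_{2n+2}(g) = P_n(2|a(g)|² − 1)`. -/
theorem sph_even_eq (n : ℕ) (g : SU11) : sph (2 * (n : ℝ) + 2) g = legP n (2 * ‖mat g 0 0‖ ^ 2 - 1) := by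
  have h4 : Real.cosh (2 * cartanT g) = 2 * ‖mat g 0 0‖ ^ 2 - 1 := by
    rw [← sph_four g, sph_eq_sph_hyp_cartanT 4 g, sph_four_hyp]
  rw [sph_eq_sph_hyp_cartanT (2 * (n : ℝ) + 2) g, sph_even_hyp, h4]

/-- **`φ_{2n+2} = P_n(φ_4)`** on the group. -/
theorem sph_even_eq_sph_four (n : ℕ) (g : SU11) : sph (2 * (n : ℝ) + 2) g = legP n (sph 4 g) := by
  rw [sph_even_eq, sph_four]

/-- **Bonnet's recursion on the group**: `(n + 2) φ_{2n+6} = (2n + 3) φ_4 φ_{2n+4} − (n + 1) φ_{2n+2}` — the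
three-term recursion of the spherical functions of even integer parameter, with `φ_4` as the multiplier. -/
theorem sph_even_recursion (n : ℕ) (g : SU11) :
    ((n : ℝ) + 2) * sph (2 * ((n : ℝ) + 2) + 2) g
      = (2 * (n : ℝ) + 3) * sph 4 g * sph (2 * ((n : ℝ) + 1) + 2) g - ((n : ℝ) + 1) * sph (2 * (n : ℝ) + 2) g := by
  have h2 := sph_even_eq_sph_four (n + 2) g
  have h1 := sph_even_eq_sph_four (n + 1) g
  have h0 := sph_even_eq_sph_four n g
  push_cast at h2 h1
  rw [h2, h1, h0, legP_succ_succ]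
  have hn : (n : ℝ) + 2 ≠ 0 := by positivity
  field_simp

/-- **The functional equation**: `φ_{−2n}(a_t) = P_n(cosh 2t)`. -/
theorem sph_neg_even_hyp (n : ℕ) (t : ℝ) : sph (-(2 * (n : ℝ))) (hyp t) = legP n (Real.cosh (2 * t)) := by
  rw [sph_two_sub, show (2 : ℝ) - -(2 * (n : ℝ)) = 2 * (n : ℝ) + 2 by ring, sph_even_hyp]

/-- The cross-check `n = 2`: `φ_6(a_t) = P_2(cosh 2t)` (`T5SU11SphericalLegendreHigher.sph_six_hyp`). -/
theorem sph_six_hyp' (t : ℝ) : sph 6 (hyp t) = (3 * Real.cosh (2 * t) ^ 2 - 1) / 2 := by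
  have h := sph_even_hyp 2 t
  rw [legP_two] at h
  rw [show (6 : ℝ) = 2 * ((2 : ℕ) : ℝ) + 2 by norm_num]
  exact h

/-- The cross-check `n = 3`: `φ_8(a_t) = P_3(cosh 2t)` (`T5SU11SphericalLegendreHigher.sph_eight_hyp`). -/
theorem sph_eight_hyp' (t : ℝ) : sph 8 (hyp t) = (5 * Real.cosh (2 * t) ^ 3 - 3 * Real.cosh (2 * t)) / 2 := by
  have h := sph_even_hyp 3 t
  rw [legP_three] at h
  rw [show (8 : ℝ) = 2 * ((3 : ℕ) : ℝ) + 2 by norm_num]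
  exact h

/-! ### Legendre facts read off the group: `P_n ≥ 1` and `P_n` strictly increasing on `[1, ∞)` -/

omit [MeasurableSpace Circle] [BorelSpace Circle] in
/-- Every `x ≥ 1` is `cosh 2t` for `t = arcosh x / 2 ≥ 0`. -/
theorem exists_cosh_two_mul_eq {x : ℝ} (hx : 1 ≤ x) : ∃ t : ℝ, 0 ≤ t ∧ Real.cosh (2 * t) = x :=
  ⟨Real.arcosh x / 2, by linarith [Real.arcosh_nonneg hx], by
    rw [show 2 * (Real.arcosh x / 2) = Real.arcosh x by ring, Real.cosh_arcosh hx]⟩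

/-- **`P_n(x) ≥ 1` for `x ≥ 1`** — because `φ_{2n+2}(a_t) ≥ 1` (`T5SU11SphericalBounds.one_le_sph_hyp_of_two_le`). -/
theorem one_le_legP (n : ℕ) {x : ℝ} (hx : 1 ≤ x) : 1 ≤ legP n x := by
  obtain ⟨t, -, ht⟩ := exists_cosh_two_mul_eq hx
  rw [← ht, ← sph_even_hyp]
  exact one_le_sph_hyp_of_two_le (by linarith [(Nat.cast_nonneg n : (0 : ℝ) ≤ n)]) t

/-- **`P_n` is strictly increasing on `[1, ∞)` for `n ≥ 1`** — because `t ↦ φ_{2n+2}(a_t)` is strictly increasing on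
`[0, ∞)` for `2n + 2 > 2` (`T5SU11SphericalMonotone.strictMonoOn_sph_hyp`). -/
theorem strictMonoOn_legP {n : ℕ} (hn : 1 ≤ n) : StrictMonoOn (legP n) (Ici 1) := by
  intro x hx y hy hxy
  obtain ⟨s, hs0, hs⟩ := exists_cosh_two_mul_eq (mem_Ici.mp hx)
  obtain ⟨t, ht0, ht⟩ := exists_cosh_two_mul_eq (mem_Ici.mp hy)
  rw [← hs, ← ht, ← sph_even_hyp, ← sph_even_hyp]
  have hlam : (2 * (n : ℝ) + 2 : ℝ) > 2 := by
    have : (1 : ℝ) ≤ n := by exact_mod_cast hn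
    linarith
  refine strictMonoOn_sph_hyp (Or.inr hlam) (mem_Ici.mpr hs0) (mem_Ici.mpr ht0) ?_
  -- `cosh 2s < cosh 2t` with `s, t ≥ 0` forces `s < t`
  by_contra hst
  rw [not_lt] at hst
  have : Real.cosh (2 * t) ≤ Real.cosh (2 * s) := by
    rw [← Real.cosh_abs (2 * t), ← Real.cosh_abs (2 * s), abs_of_nonneg (by linarith), abs_of_nonneg (by linarith)]
    exact Real.cosh_le_cosh.mpr (by rw [abs_of_nonneg (by linarith), abs_of_nonneg (by linarith)]; linarith)
  linarith

end measure

end Summit.Ventures.HodgeRepro2.T5SU11SphericalLegendreAll
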